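import Literature.NumberTheory.Sieve.CoprimeMoebiusLogSumsTwisted
import Literature.NumberTheory.Sieve.FriedlanderIwaniecPrimesProp21Lemmas
import Literature.NumberTheory.LFunctions.MertensElementary
import Mathlib.NumberTheory.ArithmeticFunction.Moebius
import HarnessLib

/-!
# Graham's two-level sieve weights and the Selberg diagonalisation at `1 + δ`

Topic `Literature/NumberTheory/Sieve`. Everything here is PROVED. The two-level weights of
Graham (Heath-Brown, *Zero-free regions …*, PLMS 64 (1992), (11.6)):
`ψ_d = μ(d)` for `d ≤ U`, `ψ_d = μ(d) log(V/d)/log(V/U)` for `U ≤ d ≤ V`, `ψ_d = 0` for `d ≥ V`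
(`GrahamWeights.psi`), their divisor sums `(ψ∗1)(n) = Σ_{d∣n} ψ_d` (`psiStar`), which are `1`
at `n = 1` and vanish for `1 < n ≤ U` (`psiStar_eq_zero`), and the quadratic form
`D_ψ(ω) = Σ_{d,e} ψ_d ψ_e [d,e]^{-ω}` at a real `ω = 1 + δ`. Selberg's diagonalisation
(`sum_sum_mul_lcm_rpow_eq`): for coefficients supported on square-free `d ≤ N`,
`Σ_{d,e} a_d a_e [d,e]^{-ω} = Σ_r φ_ω(r) (Σ_{r∣d} a_d d^{-ω})²`, `φ_ω(r) = Π_{p∣r}(p^ω − 1)`;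
for the Graham weights the inner sums are differences of the twisted coprime Möbius log sums
of `CoprimeMoebiusLogSumsTwisted`, whence (`quadForm_psi_le`)
`D_ψ(1+δ) ≤ 196 (1 + δ log V)² e^{C} (log log V + 5) · (log V)/… ` — precisely
`D_ψ(1+δ) ≤ 196 (1 + δ log V)² K_M log V / log²(V/U)` with an absolute `K_M`.
This is the sieve input of the `b`-side of the log-free zero-density estimate in Motohashi's
form (the Dirichlet series at `1 + 1/log X` instead of Graham's asymptotic for partial sums).

## References
* D. R. Heath-Brown, PLMS 64 (1992), §11 (11.6), (11.13)–(11.14). [cite: HeathBrown1992PLMS, §11]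
* S. W. Graham, J. Number Theory 10 (1978), 83–94. [folklore]
* Y. Motohashi, *解析的整数論 I* (Asakura, 2009), Lemma 9.4. [folklore]
-/

noncomputable section

open Finset Real ArithmeticFunction

open scoped ArithmeticFunction.Moebius

namespace Literature.NumberTheory.Sieve.GrahamWeights

/-! ### The weights -/

/-- The taper `t(d) = (log⁺(V/d) − log⁺(U/d))/log(V/U)`: `1` for `d ≤ U`, `log(V/d)/log(V/U)` for
`U ≤ d ≤ V`, `0` for `d ≥ V`. [cite: HeathBrown1992PLMS, §11 (11.6)] -/
def taper (U V : ℝ) (d : ℕ) : ℝ :=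
  (max 0 (Real.log (V / d)) - max 0 (Real.log (U / d))) / Real.log (V / U)

/-- Graham's two-level weight `ψ_d = μ(d) t(d)`. [cite: HeathBrown1992PLMS, §11 (11.6)] -/
def psi (U V : ℝ) (d : ℕ) : ℝ := (μ d : ℝ) * taper U V d

/-- `(ψ∗1)(n) = Σ_{d ∣ n} ψ_d`. [cite: HeathBrown1992PLMS, §11 (11.10)] -/
def psiStar (U V : ℝ) (n : ℕ) : ℝ := ∑ d ∈ n.divisors, psi U V d

variable {U V : ℝ}

/-- `t(d) = 1` for `1 ≤ d ≤ U` (`0 < U < V`). [folklore] -/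
theorem taper_eq_one (hU : 0 < U) (hUV : U < V) {d : ℕ} (hd : 0 < d) (hdU : (d : ℝ) ≤ U) :
    taper U V d = 1 := by
  have hd0 : (0 : ℝ) < d := by exact_mod_cast hd
  have hV : 0 < V := hU.trans hUV
  have hVU : 0 < Real.log (V / U) := Real.log_pos ((one_lt_div hU).2 hUV)
  have h1 : 0 ≤ Real.log (U / d) := Real.log_nonneg ((one_le_div hd0).2 hdU)
  have h2 : 0 ≤ Real.log (V / d) := Real.log_nonneg ((one_le_div hd0).2 (hdU.trans hUV.le))
  have hVU' : Real.log V - Real.log U ≠ 0 := by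
    rw [Real.log_div hV.ne' hU.ne'] at hVU; exact hVU.ne'
  rw [taper, max_eq_right h1, max_eq_right h2, Real.log_div hV.ne' hd0.ne',
    Real.log_div hU.ne' hd0.ne', Real.log_div hV.ne' hU.ne',
    show Real.log V - Real.log d - (Real.log U - Real.log d) = Real.log V - Real.log U by ring,
    div_self hVU']

/-- `t(d) = 0` for `d ≥ V` (`0 < U ≤ V`). [folklore] -/
theorem taper_eq_zero (hU : 0 < U) (hUV : U ≤ V) {d : ℕ} (hd : V ≤ d) : taper U V d = 0 := by
  have hV : 0 < V := hU.trans_le hUV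
  have hd0 : (0 : ℝ) < d := hV.trans_le hd
  have h1 : Real.log (V / d) ≤ 0 := Real.log_nonpos (by positivity) ((div_le_one hd0).2 hd)
  have h2 : Real.log (U / d) ≤ 0 :=
    Real.log_nonpos (by positivity) ((div_le_one hd0).2 (hUV.trans hd))
  rw [taper, max_eq_left h1, max_eq_left h2, sub_self, zero_div]

/-- `t(0) = 0` (junk value). [folklore] -/
theorem taper_zero (U V : ℝ) : taper U V 0 = 0 := by simp [taper]

/-- `0 ≤ t(d) ≤ 1` (`0 < U < V`). [folklore] -/
theorem taper_mem_Icc (hU : 0 < U) (hUV : U < V) (d : ℕ) : taper U V d ∈ Set.Icc (0 : ℝ) 1 := by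
  rcases Nat.eq_zero_or_pos d with rfl | hd
  · rw [taper_zero]; exact ⟨le_rfl, zero_le_one⟩
  have hd0 : (0 : ℝ) < d := by exact_mod_cast hd
  have hV : 0 < V := hU.trans hUV
  have hVU : 0 < Real.log (V / U) := Real.log_pos ((one_lt_div hU).2 hUV)
  have hle : Real.log (U / d) ≤ Real.log (V / d) :=
    Real.log_le_log (by positivity) (div_le_div_of_nonneg_right hUV.le hd0.le)
  have hdiff : Real.log (V / d) - Real.log (U / d) = Real.log (V / U) := by
    rw [Real.log_div hV.ne' hd0.ne', Real.log_div hU.ne' hd0.ne', Real.log_div hV.ne' hU.ne']; ring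
  constructor
  · exact div_nonneg (sub_nonneg.2 (max_le_max le_rfl hle)) hVU.le
  · rw [taper, div_le_one hVU, ← hdiff]
    -- `max 0 a − max 0 b ≤ a − b` when `b ≤ a`... via cases on the sign of `b`
    rcases le_or_gt 0 (Real.log (U / d)) with hb | hb
    · rw [max_eq_right hb, max_eq_right (hb.trans hle)]
    · rw [max_eq_left hb.le, sub_zero]
      have : max 0 (Real.log (V / d)) ≤ max (Real.log (V / d) - Real.log (U / d)) (Real.log (V / d)) :=
        max_le_max (by linarith) le_rfl
      refine this.trans (max_le le_rfl (by linarith))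

/-- `|ψ_d| ≤ 1`. [folklore] -/
theorem abs_psi_le_one (hU : 0 < U) (hUV : U < V) (d : ℕ) : |psi U V d| ≤ 1 := by
  have ht := taper_mem_Icc hU hUV d
  have hμ : |(μ d : ℝ)| ≤ 1 := by
    have := ArithmeticFunction.abs_moebius_le_one (n := d)
    exact_mod_cast this
  rw [psi, abs_mul, abs_of_nonneg ht.1]
  exact mul_le_one₀ hμ ht.1 ht.2

/-- `ψ_d = μ(d)` for `1 ≤ d ≤ U`. [folklore] -/
theorem psi_eq_moebius (hU : 0 < U) (hUV : U < V) {d : ℕ} (hd : 0 < d) (hdU : (d : ℝ) ≤ U) :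
    psi U V d = μ d := by
  rw [psi, taper_eq_one hU hUV hd hdU, mul_one]

/-- `ψ_d = 0` for `d ≥ V`. [folklore] -/
theorem psi_eq_zero_of_ge (hU : 0 < U) (hUV : U ≤ V) {d : ℕ} (hd : V ≤ d) : psi U V d = 0 := by
  rw [psi, taper_eq_zero hU hUV hd, mul_zero]

/-- `ψ_d = 0` unless `d` is square-free. [folklore] -/
theorem psi_eq_zero_of_not_squarefree (U V : ℝ) {d : ℕ} (hd : ¬Squarefree d) : psi U V d = 0 := by
  rw [psi, ArithmeticFunction.moebius_eq_zero_of_not_squarefree hd]; simp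

/-- `∑_{d ∣ n} μ(d) = [n = 1]` in `ℝ`. [folklore] -/
theorem sum_divisors_moebius_real (n : ℕ) :
    ∑ d ∈ n.divisors, (μ d : ℝ) = if n = 1 then 1 else 0 := by
  have h := congrArg (fun f : ArithmeticFunction ℝ ↦ f n)
    (ArithmeticFunction.coe_moebius_mul_coe_zeta (R := ℝ))
  simpa only [ArithmeticFunction.coe_mul_zeta_apply, ArithmeticFunction.intCoe_apply,
    ArithmeticFunction.one_apply] using h

/-- `(ψ∗1)(1) = 1` (`1 ≤ U < V`). [cite: HeathBrown1992PLMS, §11 (11.10)] -/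
theorem psiStar_one (hU : 1 ≤ U) (hUV : U < V) : psiStar U V 1 = 1 := by
  rw [psiStar, Nat.divisors_one, sum_singleton, psi_eq_moebius (by linarith) hUV one_pos
    (by exact_mod_cast hU)]
  simp

/-- **Exact vanishing**: `(ψ∗1)(n) = 0` for `1 < n ≤ U`. [cite: HeathBrown1992PLMS, §11 (11.10)] -/
theorem psiStar_eq_zero (hU : 0 < U) (hUV : U < V) {n : ℕ} (hn1 : 1 < n) (hnU : (n : ℝ) ≤ U) :
    psiStar U V n = 0 := by
  have : ∀ d ∈ n.divisors, psi U V d = μ d := by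
    intro d hd
    have hdpos : 0 < d := Nat.pos_of_mem_divisors hd
    have hdn : d ≤ n := Nat.divisor_le hd
    exact psi_eq_moebius hU hUV hdpos ((Nat.cast_le.2 hdn).trans hnU)
  rw [psiStar, sum_congr rfl this, sum_divisors_moebius_real, if_neg hn1.ne']

/-- `(ψ∗1)(0) = 0` (junk). [folklore] -/
theorem psiStar_zero (U V : ℝ) : psiStar U V 0 = 0 := by simp [psiStar]

/-- The divisor sum may be taken over `d ≤ N` for any `N ≥ ⌊V⌋`: `(ψ∗1)(n) = Σ_{d ≤ N, d ∣ n} ψ_d`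
(`n ≥ 1`). [folklore] -/
theorem psiStar_eq_sum_filter (hU : 0 < U) (hUV : U ≤ V) {N : ℕ} (hN : ⌊V⌋₊ ≤ N) {n : ℕ}
    (hn : n ≠ 0) : psiStar U V n = ∑ d ∈ (Icc 1 N).filter (· ∣ n), psi U V d := by
  rw [psiStar]
  have h1 : ∑ d ∈ n.divisors, psi U V d = ∑ d ∈ n.divisors.filter (fun d => d ≤ N), psi U V d := by
    rw [sum_filter]
    refine sum_congr rfl fun d hd => ?_
    split_ifs with h
    · rfl
    · push Not at h
      have hVd : V ≤ d := by
        have h1 : V < (⌊V⌋₊ : ℝ) + 1 := Nat.lt_floor_add_one V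
        have h2 : (⌊V⌋₊ : ℝ) + 1 ≤ d := by exact_mod_cast (hN.trans_lt h)
        linarith
      exact psi_eq_zero_of_ge hU hUV hVd
  rw [h1]
  refine sum_congr ?_ fun _ _ => rfl
  ext d
  simp only [mem_filter, Nat.mem_divisors, mem_Icc]
  constructor
  · rintro ⟨⟨hdn, -⟩, hdN⟩
    exact ⟨⟨Nat.pos_of_dvd_of_pos hdn (Nat.pos_of_ne_zero hn), hdN⟩, hdn⟩
  · rintro ⟨⟨hd1, hdN⟩, hdn⟩
    exact ⟨⟨hdn, hn⟩, hdN⟩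

/-! ### Selberg's diagonalisation -/

/-- `φ_ω(r) = Π_{p ∣ r} (p^ω − 1)`. [folklore] -/
def phiOmega (ω : ℝ) (r : ℕ) : ℝ := ∏ p ∈ r.primeFactors, ((p : ℝ) ^ ω - 1)

/-- `φ_ω(r) ≥ 0` for `ω ≥ 0`. [folklore] -/
theorem phiOmega_nonneg {ω : ℝ} (hω : 0 ≤ ω) (r : ℕ) : 0 ≤ phiOmega ω r := by
  refine prod_nonneg fun p hp => ?_
  have hp1 : (1 : ℝ) ≤ p := by exact_mod_cast (Nat.prime_of_mem_primeFactors hp).one_le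
  linarith [Real.one_le_rpow hp1 hω]

/-- `φ_ω(r) ≤ r^ω` for square-free `r` and `ω ≥ 0`. [folklore] -/
theorem phiOmega_le_rpow {ω : ℝ} (hω : 0 ≤ ω) {r : ℕ} (hr : Squarefree r) :
    phiOmega ω r ≤ (r : ℝ) ^ ω := by
  have : (r : ℝ) ^ ω = ∏ p ∈ r.primeFactors, (p : ℝ) ^ ω := by
    conv_lhs => rw [← Nat.prod_primeFactors_of_squarefree hr]
    rw [Nat.cast_prod, Real.finsetProd_rpow _ _ fun p _ => Nat.cast_nonneg p]
  rw [this, phiOmega]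
  refine prod_le_prod (fun p hp => ?_) fun p hp => by linarith
  have hp1 : (1 : ℝ) ≤ p := by exact_mod_cast (Nat.prime_of_mem_primeFactors hp).one_le
  linarith [Real.one_le_rpow hp1 hω]

/-- `Σ_{r ∣ g} φ_ω(r) = g^ω` for square-free `g`. [folklore] -/
theorem sum_divisors_phiOmega {g : ℕ} (hg : Squarefree g) (ω : ℝ) :
    ∑ r ∈ g.divisors, phiOmega ω r = (g : ℝ) ^ ω := by
  set f : ArithmeticFunction ℝ := ArithmeticFunction.prodPrimeFactors fun p => (p : ℝ) ^ ω - 1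
    with hf
  have hfm : f.IsMultiplicative := ArithmeticFunction.IsMultiplicative.prodPrimeFactors _
  have hfr : ∀ r ∈ g.divisors, phiOmega ω r = f r := by
    intro r hr
    rw [hf, ArithmeticFunction.prodPrimeFactors_apply (Nat.pos_of_mem_divisors hr).ne', phiOmega]
  rw [sum_congr rfl hfr, ← hfm.prodPrimeFactors_one_add_of_squarefree hg]
  have hfp : ∀ p ∈ g.primeFactors, (1 : ℝ) + f p = (p : ℝ) ^ ω := by
    intro p hp
    have hpr := Nat.prime_of_mem_primeFactors hp
    rw [hf, ArithmeticFunction.prodPrimeFactors_apply hpr.ne_zero, hpr.primeFactors, prod_singleton]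
    ring
  rw [prod_congr rfl hfp]
  conv_rhs => rw [← Nat.prod_primeFactors_of_squarefree hg]
  rw [Nat.cast_prod, Real.finsetProd_rpow _ _ fun p _ => Nat.cast_nonneg p]

/-- `[d,e]^{-ω} = (de)^{-ω} Σ_{r ∣ d, r ∣ e} φ_ω(r)` for square-free `d, e ≥ 1`, the `r`-sum taken
over `r ≤ N` for any `N ≥ d`. [folklore] -/
theorem lcm_rpow_neg_eq {ω : ℝ} {d e N : ℕ} (hd : Squarefree d) (he : Squarefree e) (hdN : d ≤ N) :
    ((Nat.lcm d e : ℕ) : ℝ) ^ (-ω) =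
      ((d : ℝ) * e) ^ (-ω) * ∑ r ∈ (Icc 1 N).filter (fun r => r ∣ d ∧ r ∣ e), phiOmega ω r := by
  have hd0 : d ≠ 0 := hd.ne_zero
  have he0 : e ≠ 0 := he.ne_zero
  have hg : Squarefree (Nat.gcd d e) := hd.squarefree_of_dvd (Nat.gcd_dvd_left d e)
  -- the `r`-sum is the divisor sum of `gcd d e`
  have hset : (Icc 1 N).filter (fun r => r ∣ d ∧ r ∣ e) = (Nat.gcd d e).divisors := by
    ext r
    simp only [mem_filter, mem_Icc, Nat.mem_divisors, Nat.dvd_gcd_iff, ne_eq,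
      Nat.gcd_eq_zero_iff, hd0, he0, and_self, not_false_eq_true, and_true]
    constructor
    · rintro ⟨-, h⟩; exact h
    · rintro h
      exact ⟨⟨Nat.pos_of_dvd_of_pos h.1 (Nat.pos_of_ne_zero hd0),
        (Nat.le_of_dvd (Nat.pos_of_ne_zero hd0) h.1).trans hdN⟩, h⟩
  rw [hset, sum_divisors_phiOmega hg]
  have hlcm : ((Nat.lcm d e : ℕ) : ℝ) * (Nat.gcd d e : ℕ) = (d : ℝ) * e := by
    have := Nat.gcd_mul_lcm d e
    have h' : (Nat.lcm d e * Nat.gcd d e : ℕ) = d * e := by rw [mul_comm]; exact this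
    exact_mod_cast h'
  have hgpos : (0 : ℝ) < (Nat.gcd d e : ℕ) := by exact_mod_cast Nat.gcd_pos_of_pos_left e (Nat.pos_of_ne_zero hd0)
  have hlpos : (0 : ℝ) < (Nat.lcm d e : ℕ) := by exact_mod_cast Nat.pos_of_ne_zero (Nat.lcm_ne_zero hd0 he0)
  rw [← hlcm, Real.mul_rpow hlpos.le hgpos.le, mul_assoc, ← Real.rpow_add hgpos, neg_add_cancel,
    Real.rpow_zero, mul_one]

/-- **Selberg's diagonalisation.** For coefficients `a` vanishing off the square-free numbers and a
real `ω`, with `S = [1, N]`: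
`Σ_{d,e ∈ S} a_d a_e [d,e]^{-ω} = Σ_{r ∈ S} φ_ω(r) (Σ_{d ∈ S, r ∣ d} a_d d^{-ω})²`. [folklore] -/
theorem sum_sum_mul_lcm_rpow_eq (a : ℕ → ℝ) (ha : ∀ d, ¬Squarefree d → a d = 0) (ω : ℝ) (N : ℕ) :
    ∑ d ∈ Icc 1 N, ∑ e ∈ Icc 1 N, a d * a e * ((Nat.lcm d e : ℕ) : ℝ) ^ (-ω) =
      ∑ r ∈ Icc 1 N, phiOmega ω r *
        (∑ d ∈ (Icc 1 N).filter (fun d => r ∣ d), a d * (d : ℝ) ^ (-ω)) ^ 2 := by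
  -- expand `[d,e]^{-ω}` by `lcm_rpow_neg_eq` (terms with `a = 0` are trivially equal)
  have hexp : ∀ d ∈ Icc 1 N, ∀ e ∈ Icc 1 N, a d * a e * ((Nat.lcm d e : ℕ) : ℝ) ^ (-ω) =
      ∑ r ∈ Icc 1 N, if r ∣ d ∧ r ∣ e then
        phiOmega ω r * (a d * (d : ℝ) ^ (-ω)) * (a e * (e : ℝ) ^ (-ω)) else 0 := by
    intro d hd e he
    by_cases hds : Squarefree d
    · by_cases hes : Squarefree e
      · rw [lcm_rpow_neg_eq hds hes (mem_Icc.1 hd).2, Finset.sum_filter]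
        simp_rw [Finset.mul_sum]
        refine sum_congr rfl fun r _ => ?_
        have hdpos : (0 : ℝ) ≤ d := Nat.cast_nonneg d
        have hepos : (0 : ℝ) ≤ e := Nat.cast_nonneg e
        rw [Real.mul_rpow hdpos hepos]
        split_ifs
        · ring
        · simp
      · rw [ha e hes]; simp
    · rw [ha d hds]; simp
  rw [sum_congr rfl fun d hd => sum_congr rfl fun e he => hexp d hd e he]
  have hsw : ∀ d ∈ Icc 1 N, (∑ e ∈ Icc 1 N, ∑ r ∈ Icc 1 N, if r ∣ d ∧ r ∣ e then
      phiOmega ω r * (a d * (d : ℝ) ^ (-ω)) * (a e * (e : ℝ) ^ (-ω)) else 0) =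
      ∑ r ∈ Icc 1 N, ∑ e ∈ Icc 1 N, if r ∣ d ∧ r ∣ e then
      phiOmega ω r * (a d * (d : ℝ) ^ (-ω)) * (a e * (e : ℝ) ^ (-ω)) else 0 :=
    fun d _ => Finset.sum_comm
  rw [sum_congr rfl hsw, Finset.sum_comm]
  refine sum_congr rfl fun r _ => ?_
  rw [sq, sum_filter, sum_mul_sum, mul_sum]
  refine sum_congr rfl fun d _ => ?_
  rw [mul_sum]
  refine sum_congr rfl fun e _ => ?_
  by_cases h1 : r ∣ d <;> by_cases h2 : r ∣ e <;> simp [h1, h2]; ring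


/-! ### The diagonal coefficients of the Graham weights -/

/-- The twisted coprime Möbius log sum `T_r(Y) = Σ_{m ≤ Y, (m,r)=1} μ(m) m^{-1-δ} log(Y/m)` of
`CoprimeMoebiusLogSumsTwisted`, in the shape used here. [folklore] -/
def twSum (r : ℕ) (δ Y : ℝ) : ℝ :=
  ∑ m ∈ (Icc 1 ⌊Y⌋₊).filter (fun m => m.Coprime r),
    ((μ m : ℤ) : ℝ) / m * (m : ℝ) ^ (-δ) * Real.log (Y / m)

/-- `|T_r(Y)| ≤ (r/φ(r) + 6)(1 + δ log W)` for `Y ≤ W`, `1 ≤ W`; for `Y < 1` the sum is empty.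
[folklore] -/
theorem abs_twSum_le {r : ℕ} (hr : r ≠ 0) {δ : ℝ} (hδ : 0 ≤ δ) {Y W : ℝ} (hYW : Y ≤ W)
    (hW : 1 ≤ W) : |twSum r δ Y| ≤ ((r : ℝ) / r.totient + 6) * (1 + δ * Real.log W) := by
  have hlogW : 0 ≤ Real.log W := Real.log_nonneg hW
  rcases lt_or_ge Y 1 with hY | hY
  · have h0 : ⌊Y⌋₊ = 0 := Nat.floor_eq_zero.2 hY
    rw [twSum, h0]
    simp only [show Icc 1 0 = (∅ : Finset ℕ) by rfl, filter_empty, sum_empty, abs_zero]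
    positivity
  · refine (CoprimeMoebius.abs_sum_coprime_moebius_rpow_log_le hr hδ hY).trans ?_
    refine mul_le_mul_of_nonneg_left ?_ (by positivity)
    have := Real.log_le_log (by linarith) hYW
    nlinarith

/-- The twisted sum over the longer range `m ≤ M` (`⌊Y⌋ ≤ M`) with `log⁺`:
`T_r(Y) = Σ_{m ≤ M, (m,r)=1} μ(m) m^{-1-δ} log⁺(Y/m)`. [folklore] -/
theorem twSum_eq_sum_max {r : ℕ} (δ : ℝ) {Y : ℝ} (hY0 : 0 ≤ Y) {M : ℕ} (hM : ⌊Y⌋₊ ≤ M) :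
    twSum r δ Y = ∑ m ∈ Icc 1 M, if m.Coprime r then
      ((μ m : ℤ) : ℝ) / m * (m : ℝ) ^ (-δ) * max 0 (Real.log (Y / m)) else 0 := by
  rw [twSum, ← sum_filter]
  have hsub : (Icc 1 ⌊Y⌋₊).filter (fun m => m.Coprime r) ⊆ (Icc 1 M).filter (fun m => m.Coprime r) := by
    intro m hm
    simp only [mem_filter, mem_Icc] at hm ⊢
    exact ⟨⟨hm.1.1, hm.1.2.trans hM⟩, hm.2⟩
  rw [← sum_subset hsub]
  · refine sum_congr rfl fun m hm => ?_
    simp only [mem_filter, mem_Icc] at hm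
    have hm0 : (0 : ℝ) < m := by exact_mod_cast hm.1.1
    rcases lt_or_ge Y 1 with hY | hY
    · exfalso
      have : ⌊Y⌋₊ = 0 := Nat.floor_eq_zero.2 hY
      omega
    have hmY : (m : ℝ) ≤ Y := (Nat.floor_le (by linarith)).trans' (by exact_mod_cast hm.1.2)
    rw [max_eq_right (Real.log_nonneg ((one_le_div hm0).2 hmY))]
  · intro m hmM hmn
    simp only [mem_filter, mem_Icc] at hmM hmn
    have hmY : Y < m := by
      by_contra h
      push Not at h
      exact hmn ⟨⟨hmM.1.1, Nat.le_floor h⟩, hmM.2⟩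
    have hm0 : (0 : ℝ) < m := by exact_mod_cast hmM.1.1
    rw [max_eq_left (Real.log_nonpos (div_nonneg hY0 hm0.le) ((div_le_one hm0).2 hmY.le))]
    simp

/-- `⌊Y/r⌋ ≤ ⌊V⌋/r` for `Y ≤ V`, `V ≥ 0`. [folklore] -/
theorem floor_div_le {Y V : ℝ} (hYV : Y ≤ V) (r : ℕ) : ⌊Y / r⌋₊ ≤ ⌊V⌋₊ / r := by
  rw [← Nat.floor_div_natCast]
  rcases Nat.eq_zero_or_pos r with rfl | hr
  · simp
  · exact Nat.floor_mono (div_le_div_of_nonneg_right hYV (by exact_mod_cast hr.le))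

/-- **The diagonal coefficient** of the Graham weights:
`y_r = Σ_{d ≤ ⌊V⌋, r ∣ d} ψ_d d^{-(1+δ)} = μ(r) r^{-(1+δ)} (T_r(V/r) − T_r(U/r))/log(V/U)` (`r ≥ 1`).
[cite: HeathBrown1992PLMS, §11 (11.6)] -/
theorem diagCoeff_eq (hU : 1 ≤ U) (hUV : U < V) (δ : ℝ) {r : ℕ} (hr : 0 < r) :
    ∑ d ∈ (Icc 1 ⌊V⌋₊).filter (fun d => r ∣ d), psi U V d * (d : ℝ) ^ (-(1 + δ)) =
      (μ r : ℝ) * (r : ℝ) ^ (-(1 + δ)) / Real.log (V / U) *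
        (twSum r δ (V / r) - twSum r δ (U / r)) := by
  have hU0 : 0 < U := by linarith
  have hV0 : 0 < V := hU0.trans hUV
  have hr0 : (0 : ℝ) < r := by exact_mod_cast hr
  set N : ℕ := ⌊V⌋₊ with hN
  -- reindex `d = r m`, `1 ≤ m ≤ N / r`
  have hreindex : (Icc 1 N).filter (fun d => r ∣ d) = (Icc 1 (N / r)).image (fun m => r * m) := by
    ext d
    simp only [mem_filter, mem_Icc, mem_image]
    constructor
    · rintro ⟨⟨hd1, hdN⟩, ⟨m, rfl⟩⟩
      refine ⟨m, ⟨?_, ?_⟩, rfl⟩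
      · rcases Nat.eq_zero_or_pos m with rfl | hm
        · simp at hd1
        · exact hm
      · exact (Nat.le_div_iff_mul_le hr).2 (by rw [mul_comm]; exact hdN)
    · rintro ⟨m, ⟨hm1, hmN⟩, rfl⟩
      refine ⟨⟨Nat.mul_pos hr hm1, ?_⟩, dvd_mul_right r m⟩
      have := (Nat.le_div_iff_mul_le hr).1 hmN
      rw [mul_comm]; exact this
  rw [hreindex, sum_image (fun a _ b _ h => Nat.eq_of_mul_eq_mul_left hr h)]
  -- the two `log⁺` sums
  have hMV : ⌊V / r⌋₊ ≤ N / r := floor_div_le le_rfl r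
  have hMU : ⌊U / r⌋₊ ≤ N / r := floor_div_le hUV.le r
  rw [twSum_eq_sum_max δ (div_nonneg hV0.le hr0.le) hMV,
    twSum_eq_sum_max δ (div_nonneg hU0.le hr0.le) hMU, ← sum_sub_distrib, mul_sum]
  refine sum_congr rfl fun m hm => ?_
  have hm0 : 0 < m := (mem_Icc.1 hm).1
  have hm0' : (0 : ℝ) < m := by exact_mod_cast hm0
  by_cases hcop : m.Coprime r
  · rw [if_pos hcop, if_pos hcop]
    have hμ : (μ (r * m) : ℝ) = μ r * μ m := by
      have := ArithmeticFunction.isMultiplicative_moebius.map_mul_of_coprime hcop.symm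
      exact_mod_cast this
    have hrm : ((r * m : ℕ) : ℝ) ^ (-(1 + δ)) = (r : ℝ) ^ (-(1 + δ)) * ((m : ℝ)⁻¹ * (m : ℝ) ^ (-δ)) := by
      rw [Nat.cast_mul, Real.mul_rpow hr0.le hm0'.le, show (-(1 + δ) : ℝ) = -1 + -δ by ring,
        Real.rpow_add hm0', Real.rpow_neg_one]
    rw [psi, taper, hμ, hrm, Nat.cast_mul, ← div_div, ← div_div]
    field_simp
  · rw [if_neg hcop, if_neg hcop, sub_zero, mul_zero]
    have hns : ¬Squarefree (r * m) := fun hsq =>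
      hcop ((Nat.squarefree_mul_iff.1 hsq).1).symm
    rw [psi_eq_zero_of_not_squarefree U V hns, zero_mul]

/-- `y_r = 0` unless `r` is square-free. [folklore] -/
theorem diagCoeff_eq_zero_of_not_squarefree (U V : ℝ) (ω : ℝ) {r : ℕ} (hr : ¬Squarefree r) (N : ℕ) :
    ∑ d ∈ (Icc 1 N).filter (fun d => r ∣ d), psi U V d * (d : ℝ) ^ (-ω) = 0 := by
  refine sum_eq_zero fun d hd => ?_
  have hdr : r ∣ d := (mem_filter.1 hd).2
  have : ¬Squarefree d := fun hds => hr (hds.squarefree_of_dvd hdr)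
  rw [psi_eq_zero_of_not_squarefree U V this, zero_mul]

/-- **Bound for the diagonal coefficients**: for `1 ≤ r`, `δ ≥ 0`, `1 ≤ U < V`,
`|y_r| ≤ r^{-(1+δ)} · 2 (r/φ(r) + 6)(1 + δ log V)/log(V/U)`. [folklore] -/
theorem abs_diagCoeff_le (hU : 1 ≤ U) (hUV : U < V) {δ : ℝ} (hδ : 0 ≤ δ) {r : ℕ} (hr : 0 < r) :
    |∑ d ∈ (Icc 1 ⌊V⌋₊).filter (fun d => r ∣ d), psi U V d * (d : ℝ) ^ (-(1 + δ))| ≤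
      (r : ℝ) ^ (-(1 + δ)) * (2 * ((r : ℝ) / r.totient + 6) * (1 + δ * Real.log V)) /
        Real.log (V / U) := by
  have hU0 : 0 < U := by linarith
  have hV1 : 1 ≤ V := hU.trans hUV.le
  have hr0 : (0 : ℝ) < r := by exact_mod_cast hr
  have hr1 : (1 : ℝ) ≤ r := by exact_mod_cast hr
  have hVU : 0 < Real.log (V / U) := Real.log_pos ((one_lt_div hU0).2 hUV)
  rw [diagCoeff_eq hU hUV δ hr]
  have hμ : |(μ r : ℝ)| ≤ 1 := by exact_mod_cast ArithmeticFunction.abs_moebius_le_one (n := r)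
  have hT1 := abs_twSum_le hr.ne' hδ (Y := V / r) (div_le_self (by linarith) hr1) hV1
  have hT2 := abs_twSum_le hr.ne' hδ (Y := U / r) ((div_le_self hU0.le hr1).trans hUV.le) hV1
  have hdiff : |twSum r δ (V / r) - twSum r δ (U / r)| ≤
      2 * ((r : ℝ) / r.totient + 6) * (1 + δ * Real.log V) := by
    have := abs_sub (twSum r δ (V / r)) (twSum r δ (U / r))
    linarith
  rw [abs_mul, abs_div, abs_mul, abs_of_pos hVU, abs_of_nonneg (Real.rpow_nonneg hr0.le _),
    div_mul_eq_mul_div]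
  refine div_le_div_of_nonneg_right ?_ hVU.le
  calc |(μ r : ℝ)| * (r : ℝ) ^ (-(1 + δ)) * |twSum r δ (V / r) - twSum r δ (U / r)|
      ≤ 1 * (r : ℝ) ^ (-(1 + δ)) * (2 * ((r : ℝ) / r.totient + 6) * (1 + δ * Real.log V)) := by
        gcongr
    _ = _ := by ring

/-! ### The quadratic form -/

/-- `D_ψ(ω) = Σ_{d,e ≤ ⌊V⌋} ψ_d ψ_e [d,e]^{-ω}`. [cite: HeathBrown1992PLMS, §11 (11.14)] -/
def quadForm (U V ω : ℝ) : ℝ :=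
  ∑ d ∈ Icc 1 ⌊V⌋₊, ∑ e ∈ Icc 1 ⌊V⌋₊, psi U V d * psi U V e * ((Nat.lcm d e : ℕ) : ℝ) ^ (-ω)

/-- `F(r) = (r/φ(r))²/r` is multiplicative on coprime pairs, `F(1) = 1`, and
`F(p) ≤ 1/p + 6/p²` at primes. [folklore] -/
theorem totRatioSq_mul {a b : ℕ} (hab : a.Coprime b) :
    ((a * b : ℕ) : ℝ) / (a * b).totient * (((a * b : ℕ) : ℝ) / (a * b).totient) / (a * b : ℕ) =
      ((a : ℝ) / a.totient * ((a : ℝ) / a.totient) / a) *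
        ((b : ℝ) / b.totient * ((b : ℝ) / b.totient) / b) := by
  rw [Nat.totient_mul hab]
  push_cast
  rcases Nat.eq_zero_or_pos a with rfl | ha
  · simp
  rcases Nat.eq_zero_or_pos b with rfl | hb
  · simp
  have hφa : (0 : ℝ) < a.totient := by exact_mod_cast Nat.totient_pos.2 ha
  have hφb : (0 : ℝ) < b.totient := by exact_mod_cast Nat.totient_pos.2 hb
  have ha' : (0 : ℝ) < a := by exact_mod_cast ha
  have hb' : (0 : ℝ) < b := by exact_mod_cast hb
  field_simp

/-- `(p/φ(p))²/p ≤ 1/p + 6/p²` at primes. [folklore] -/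
theorem totRatioSq_prime {p : ℕ} (hp : p.Prime) :
    (p : ℝ) / p.totient * ((p : ℝ) / p.totient) / p ≤ 1 / p + 6 / (p : ℝ) ^ 2 := by
  rw [Nat.totient_prime hp]
  have hp2 : (2 : ℝ) ≤ p := by exact_mod_cast hp.two_le
  have hp1 : ((p - 1 : ℕ) : ℝ) = (p : ℝ) - 1 := by
    rw [Nat.cast_sub hp.one_le]; simp
  rw [hp1]
  have h0 : (0 : ℝ) < (p : ℝ) - 1 := by linarith
  have hp0 : (0 : ℝ) < p := by linarith
  have key : (p : ℝ) ^ 3 ≤ ((p : ℝ) - 1) ^ 2 * (p + 6) := by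
    nlinarith [mul_nonneg (by linarith : (0 : ℝ) ≤ 4 * p - 3) (by linarith : (0 : ℝ) ≤ p - 2)]
  rw [show (p : ℝ) / ((p : ℝ) - 1) * ((p : ℝ) / ((p : ℝ) - 1)) / p = p / ((p : ℝ) - 1) ^ 2 by
    field_simp, show 1 / (p : ℝ) + 6 / (p : ℝ) ^ 2 = ((p : ℝ) + 6) / (p : ℝ) ^ 2 by
    field_simp, div_le_div_iff₀ (by positivity) (by positivity)]
  nlinarith [key]

/-- `Σ_{r ≤ N}^♭ (r/φ(r))²/r ≤ e^{10} log N` for `N ≥ 2` (Euler product and Mertens). [folklore] -/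
theorem sum_sqfree_totRatioSq_div_le {N : ℕ} (hN : 2 ≤ N) :
    ∑ r ∈ (Icc 1 N).filter Squarefree, (r : ℝ) / r.totient * ((r : ℝ) / r.totient) / r ≤
      Real.exp 10 * Real.log N := by
  have h := ASPTheorem2.sum_sqfree_le_exp (F := fun r : ℕ => (r : ℝ) / r.totient * ((r : ℝ) / r.totient) / r)
    (fun r _ => by positivity) (by simp) (fun a b hab => totRatioSq_mul hab)
    (u := fun p : ℕ => 1 / (p : ℝ) + 6 / (p : ℝ) ^ 2) (fun p _ => by positivity)
    (fun p hp => totRatioSq_prime hp) N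
  refine h.trans ?_
  have hsum : ∑ p ∈ Nat.primesLE N, (1 / (p : ℝ) + 6 / (p : ℝ) ^ 2) ≤ Real.log (Real.log N) + 10 := by
    rw [sum_add_distrib]
    have h1 := Literature.NumberTheory.LFunctions.MertensBound.sum_inv_prime_le N hN
    have h2 := FriedlanderIwaniecPrimes.sum_primesLE_inv_sq_le_one N
    have h2' : ∑ p ∈ Nat.primesLE N, 6 / (p : ℝ) ^ 2 ≤ 6 := by
      rw [show ∑ p ∈ Nat.primesLE N, 6 / (p : ℝ) ^ 2 = 6 * ∑ p ∈ Nat.primesLE N, ((p : ℝ) ^ 2)⁻¹ by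
        rw [mul_sum]; exact sum_congr rfl fun p _ => by rw [div_eq_mul_inv]]
      linarith
    linarith
  have hlogN : 0 < Real.log N := Real.log_pos (by exact_mod_cast hN)
  calc Real.exp (∑ p ∈ Nat.primesLE N, (1 / (p : ℝ) + 6 / (p : ℝ) ^ 2))
      ≤ Real.exp (Real.log (Real.log N) + 10) := Real.exp_le_exp.2 hsum
    _ = Real.exp 10 * Real.log N := by rw [Real.exp_add, Real.exp_log hlogN, mul_comm]

/-- **The quadratic form of the Graham weights at `1 + δ`.** For `1 ≤ U < V`, `2 ≤ V`, `δ ≥ 0`: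
`D_ψ(1+δ) ≤ 4 e^{10} (1 + δ log V)² (⌊V⌋/φ-type constants absorbed) …`; precisely
`D_ψ(1+δ) ≤ 196 e^{10} (1 + δ log V)² log V / log²(V/U)`.
[cite: HeathBrown1992PLMS, §11 (11.13)–(11.14)] -/
theorem quadForm_le (hU : 1 ≤ U) (hUV : U < V) (hV : 2 ≤ V) {δ : ℝ} (hδ : 0 ≤ δ) :
    quadForm U V (1 + δ) ≤
      196 * Real.exp 10 * (1 + δ * Real.log V) ^ 2 * Real.log V / Real.log (V / U) ^ 2 := by
  have hU0 : 0 < U := by linarith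
  have hVU : 0 < Real.log (V / U) := Real.log_pos ((one_lt_div hU0).2 hUV)
  have hlogV : 0 < Real.log V := Real.log_pos (by linarith)
  set N : ℕ := ⌊V⌋₊ with hN
  have hN2 : 2 ≤ N := Nat.le_floor (by exact_mod_cast hV)
  have hNV : Real.log N ≤ Real.log V :=
    Real.log_le_log (by exact_mod_cast (show 0 < N by omega)) (Nat.floor_le (by linarith))
  set B : ℝ := 2 * (1 + δ * Real.log V) / Real.log (V / U) with hB
  have hB0 : 0 ≤ B := by positivity
  -- diagonalise
  have hdiag := sum_sum_mul_lcm_rpow_eq (psi U V) (fun d hd => psi_eq_zero_of_not_squarefree U V hd)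
    (1 + δ) N
  rw [quadForm, ← hN, hdiag]
  -- bound each term: `φ_ω(r) y_r² ≤ B² F(r) (r/φ+6)²/… `; non-square-free `r` give `0`
  have hterm : ∀ r ∈ Icc 1 N, phiOmega (1 + δ) r *
      (∑ d ∈ (Icc 1 N).filter (fun d => r ∣ d), psi U V d * (d : ℝ) ^ (-(1 + δ))) ^ 2 ≤
      if Squarefree r then B ^ 2 * (49 * ((r : ℝ) / r.totient * ((r : ℝ) / r.totient) / r)) else 0 := by
    intro r hr
    have hr0 : 0 < r := (mem_Icc.1 hr).1
    have hr0' : (0 : ℝ) < r := by exact_mod_cast hr0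
    by_cases hsq : Squarefree r
    · rw [if_pos hsq]
      have hy := abs_diagCoeff_le hU hUV hδ hr0
      rw [← hN] at hy
      have hφ := phiOmega_le_rpow (ω := 1 + δ) (by linarith) hsq
      have hφ0 := phiOmega_nonneg (ω := 1 + δ) (by linarith) r
      set y := ∑ d ∈ (Icc 1 N).filter (fun d => r ∣ d), psi U V d * (d : ℝ) ^ (-(1 + δ)) with hy'
      set Cr : ℝ := (r : ℝ) / r.totient + 6 with hCr
      have hCr1 : 1 ≤ (r : ℝ) / r.totient := by
        rw [le_div_iff₀ (by exact_mod_cast Nat.totient_pos.2 hr0), one_mul]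
        exact_mod_cast Nat.totient_le r
      have hCr7 : Cr ≤ 7 * ((r : ℝ) / r.totient) := by rw [hCr]; linarith
      have hCr0 : 0 ≤ Cr := by rw [hCr]; positivity
      -- `y² ≤ (r^{-ω})² B² Cr²`
      have hyb : |y| ≤ (r : ℝ) ^ (-(1 + δ)) * (B * Cr) := by
        refine hy.trans (le_of_eq ?_)
        rw [hB, hCr]; ring
      have hysq : y ^ 2 ≤ ((r : ℝ) ^ (-(1 + δ))) ^ 2 * (B * Cr) ^ 2 := by
        calc y ^ 2 = |y| ^ 2 := (sq_abs y).symm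
          _ ≤ ((r : ℝ) ^ (-(1 + δ)) * (B * Cr)) ^ 2 := by
              gcongr
          _ = _ := by ring
      -- `φ_ω(r) (r^{-ω})² ≤ r^{-ω} ≤ 1/r`
      have hpow : phiOmega (1 + δ) r * ((r : ℝ) ^ (-(1 + δ))) ^ 2 ≤ 1 / r := by
        calc phiOmega (1 + δ) r * ((r : ℝ) ^ (-(1 + δ))) ^ 2
            ≤ (r : ℝ) ^ (1 + δ) * ((r : ℝ) ^ (-(1 + δ))) ^ 2 :=
              mul_le_mul_of_nonneg_right hφ (sq_nonneg _)
          _ = (r : ℝ) ^ (-(1 + δ)) := by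
              rw [sq, ← mul_assoc, ← Real.rpow_add hr0', add_neg_cancel, Real.rpow_zero, one_mul]
          _ ≤ (r : ℝ) ^ (-1 : ℝ) :=
              Real.rpow_le_rpow_of_exponent_le (by exact_mod_cast hr0) (by linarith)
          _ = 1 / r := by rw [Real.rpow_neg_one, one_div]
      calc phiOmega (1 + δ) r * y ^ 2
          ≤ phiOmega (1 + δ) r * (((r : ℝ) ^ (-(1 + δ))) ^ 2 * (B * Cr) ^ 2) :=
            mul_le_mul_of_nonneg_left hysq hφ0
        _ = (phiOmega (1 + δ) r * ((r : ℝ) ^ (-(1 + δ))) ^ 2) * (B * Cr) ^ 2 := by ring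
        _ ≤ (1 / r) * (B * Cr) ^ 2 := mul_le_mul_of_nonneg_right hpow (sq_nonneg _)
        _ ≤ (1 / r) * (B * (7 * ((r : ℝ) / r.totient))) ^ 2 := by
            gcongr
        _ = B ^ 2 * (49 * ((r : ℝ) / r.totient * ((r : ℝ) / r.totient) / r)) := by ring
    · rw [if_neg hsq, diagCoeff_eq_zero_of_not_squarefree U V (1 + δ) hsq N]
      simp
  refine (sum_le_sum hterm).trans ?_
  rw [← sum_filter, ← mul_sum, ← mul_sum]
  have hS := sum_sqfree_totRatioSq_div_le hN2
  calc B ^ 2 * (49 * ∑ r ∈ (Icc 1 N).filter Squarefree,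
        (r : ℝ) / r.totient * ((r : ℝ) / r.totient) / r)
      ≤ B ^ 2 * (49 * (Real.exp 10 * Real.log V)) := by
        gcongr
        exact hS.trans (mul_le_mul_of_nonneg_left hNV (Real.exp_nonneg _))
    _ = 196 * Real.exp 10 * (1 + δ * Real.log V) ^ 2 * Real.log V / Real.log (V / U) ^ 2 := by
        rw [hB]; field_simp; ring

end Literature.NumberTheory.Sieve.GrahamWeights
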